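import Summits.HodgeConjecture.HodgeConjecture.Theorems.HeckeOrbitCompactnessWeilLinesRankOne
import HarnessLib

/-!
# Crux `OrbitDegreeBound` (stmt-HodgeConjecture-13689), line `k_saturation` — stub `stub_weilLinesRankOne`:
# THE WEIL EIGEN-LINES HAVE RANK `≤ 1`

Route `HodgeConjecture/HeckeOrbitCompactness`; registered skeleton `Cruxes/OrbitDegreeBound/Lines/k_saturation.lean`
(`OrbitDegreeBound_of`: `stub_orbitWeilSeed` (the bet) + `stub_orbitKTransport` + `stub_weilLinesRankOne` ⟹ the crux
BY NAME). STUB 3 is, verbatim, the route's support item `WeilLinesRankOne` (stmt-HodgeConjecture-17829), proved in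
`Theorems/HeckeOrbitCompactnessWeilLinesRankOne.lean` (`heckeOrbitCompactness_weilLinesRankOne_proof`); this file
restates it under the registered stub name so that the skeleton's `sorry` is discharged by name.

HONEST STATUS. Alias of a landed theorem; nothing here is a case of the Hodge conjecture. No definition, no named
fact, no sorry. References: [vanGeemen1994HodgeAV] 4.9 and proof of Thm. 6.12.
-/

set_option linter.dupNamespace false

noncomputable section

open CategoryTheory

namespace Summit.HodgeConjecture.HodgeConjecture.Theorems.OrbitDegreeBound

/-- **Stub `stub_weilLinesRankOne` of crux `OrbitDegreeBound` (registered signature, verbatim)** — the route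
item `WeilLinesRankOne` (`heckeOrbitCompactness_weilLinesRankOne_proof`). [cite: vanGeemen1994HodgeAV, 4.9 and proof of Thm. 6.12] -/
theorem stub_weilLinesRankOne : ∀ (n d : ℕ), 1 ≤ n → 0 < d → ∀ (A : Literature.AlgebraicGeometry.Motives.AbelianVariety ℂ) (φ : A ⟶ A), A.dim = 2 * n → Literature.AlgebraicGeometry.Motives.IsSmoothProjective (2 * n) A.X → CategoryTheory.CategoryStruct.comp φ φ = -(d • CategoryTheory.CategoryStruct.id A) → (∀ c ∈ Literature.AlgebraicGeometry.HodgeTheory.weilClassesPlus A φ n d, c ≠ 0 → ∀ c' ∈ Literature.AlgebraicGeometry.HodgeTheory.weilClassesPlus A φ n d, ∃ μ : ℂ, c' = μ • c) ∧ (∀ c ∈ Literature.AlgebraicGeometry.HodgeTheory.weilClassesMinus A φ n d, c ≠ 0 → ∀ c' ∈ Literature.AlgebraicGeometry.HodgeTheory.weilClassesMinus A φ n d, ∃ μ : ℂ, c' = μ • c) :=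
  heckeOrbitCompactness_weilLinesRankOne_proof

end Summit.HodgeConjecture.HodgeConjecture.Theorems.OrbitDegreeBound

end
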